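import Literature.AlgebraicGeometry.Resolution.HenselsLemmaProofs
import Literature.AlgebraicGeometry.Resolution.SubfieldTransport
import Mathlib.FieldTheory.Minpoly.IsConjRoot
import Mathlib.FieldTheory.IsAlgClosed.AlgebraicClosure
import HarnessLib

/-!
# Conjugation preserves values over a henselian field (Kuhlmann 2010, §1.1; Endler §17)

Topic: `Literature/AlgebraicGeometry/Resolution` (valued function fields). PROVED infrastructure
for the proofs of Kuhlmann 2010 (*Elimination of ramification I*, Trans. AMS 362 (2010) =
arXiv:1003.5678), Prop. 2.18 and of the Lemma of Ostrowski ((9) of §2.3) in the tree's rendering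
of "henselian" by the uniqueness of extensions (`IsHenselianField`, `Henselization.lean`; §1.1:
"henselian … if and only if the extension of `v` from `K` to every algebraic extension field is
unique"):

1. Over a henselian `(K, O)`, a `K`-automorphism `σ` of an algebraic extension `(L, O_L)` maps
   `O_L` onto itself (uniqueness), hence PRESERVES VALUES: `v(σ z) = v(z)` — if `v(σ z) < v(z)`,
   then `v(σ^{n+1} z) ≤ v(σ^n z)` for all `n`, while `σ^n z = z` for some `n ≥ 1` (the orbit of
   `z` lies among the roots of its minimal polynomial).
2. Consequently `K`-conjugate elements `x, y` of a normal `L` (same minimal polynomial) take the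
   same value under every `p ∈ K[X]`: `v(p(x)) = v(p(y))`. This is the valuation-theoretic
   content of the classical "over a henselian field the residue polynomial of an irreducible
   polynomial is a power of an irreducible polynomial" (O. Endler, *Valuation theory*, §17), in
   the form consumed downstream: if `v(Ψ(y)) < 1` then `v(Ψ(β)) < 1` for every root `β` of the
   minimal polynomial of `y`.

## Content (everything PROVED, [folklore])

* `IsHenselianField.comap_algEquiv_eq`, `IsHenselianField.algEquiv_mem_iff`,
  `exists_pow_algEquiv_apply_eq`, `IsHenselianField.valuation_algEquiv_apply`,
  `IsHenselianField.valuation_aeval_eq_of_isConjRoot` — typed forms (any algebraic `L|K` with a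
  valuation ring `O_L` over `O`; `L|K` normal for the last).
* `IsHenselianField.valuation_aeval_eq_of_isConjRoot_of_subfield`,
  `IsHenselianField.valuation_aeval_lt_one_of_mem_aroots_minpoly` — ambient forms for a henselian
  subfield `E ≤ Ω` of an algebraically closed valued field `(Ω, V)` (the setting of
  `HenselizedFunctionFields*.lean`), through the algebraic closure of `E` in `Ω` (normal over `E`).
  (That the valuation ring `V ∩ E` of a henselian subfield is a `HenselianLocalRing` is
  `IsHenselianField.henselianLocalRing`, `HenselsLemmaProofs.lean`, applied to `hE` directly.)

## Sources

* F.-V. Kuhlmann, Trans. AMS 362 (2010) = arXiv:1003.5678, §1.1. O. Endler, *Valuation theory*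
  (1972), §17; P. Ribenboim, *Théorie des valuations* (1968).
-/

noncomputable section

open IsLocalRing Polynomial

namespace Literature.AlgebraicGeometry.Resolution

universe u

/-! ### Conjugation preserves the valuation over a henselian field -/

section Conjugation

variable {K L : Type u} [Field K] [Field L] [Algebra K L] {O : ValuationSubring K}

/-- Over a henselian `(K, O)`, a `K`-automorphism `σ` of an algebraic extension `L` maps the
(unique) valuation ring `O_L` over `O` onto itself: `σ⁻¹(O_L) = O_L`. [folklore] -/
theorem IsHenselianField.comap_algEquiv_eq [Algebra.IsAlgebraic K L] (hK : IsHenselianField K O)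
    (OL : ValuationSubring L) (hOL : OL.comap (algebraMap K L) = O) (σ : L ≃ₐ[K] L) :
    OL.comap (σ : L →+* L) = OL := by
  refine hK.eq_of_comap_eq ?_ hOL
  rw [ValuationSubring.comap_comap]
  have : (σ : L →+* L).comp (algebraMap K L) = algebraMap K L := by
    ext c
    simp
  rw [this, hOL]

/-- Over a henselian `(K, O)`: `σ z ∈ O_L ↔ z ∈ O_L` for a `K`-automorphism `σ` of the algebraic
extension `L` and the valuation ring `O_L` over `O`. [folklore] -/
theorem IsHenselianField.algEquiv_mem_iff [Algebra.IsAlgebraic K L] (hK : IsHenselianField K O)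
    (OL : ValuationSubring L) (hOL : OL.comap (algebraMap K L) = O) (σ : L ≃ₐ[K] L) (z : L) :
    σ z ∈ OL ↔ z ∈ OL := by
  conv_rhs => rw [← hK.comap_algEquiv_eq OL hOL σ]
  rw [ValuationSubring.mem_comap]
  rfl

/-- Some positive power of a `K`-automorphism fixes a given algebraic element (its orbit lies in
the finite set of roots of its minimal polynomial). [folklore] -/
theorem exists_pow_algEquiv_apply_eq [Algebra.IsAlgebraic K L] (σ : L ≃ₐ[K] L) (z : L) :
    ∃ n : ℕ, 0 < n ∧ (σ ^ n) z = z := by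
  classical
  have hz : IsIntegral K z := Algebra.IsIntegral.isIntegral z
  have hmem : ∀ n : ℕ, (σ ^ n) z ∈ (minpoly K z).rootSet L := fun n => by
    rw [Polynomial.mem_rootSet]
    refine ⟨minpoly.ne_zero hz, ?_⟩
    rw [show (σ ^ n) z = ((σ ^ n : L ≃ₐ[K] L) : L →ₐ[K] L) z from rfl, Polynomial.aeval_algHom_apply,
      minpoly.aeval, map_zero]
  let f : ℕ → (minpoly K z).rootSet L := fun n => ⟨(σ ^ n) z, hmem n⟩
  obtain ⟨i, j, hij, hfij⟩ := Finite.exists_ne_map_eq_of_infinite f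
  have hval : (σ ^ i) z = (σ ^ j) z := congrArg Subtype.val hfij
  -- w.l.o.g. `i < j`
  wlog hlt : i < j generalizing i j
  · exact this j i hij.symm hfij.symm hval.symm (lt_of_le_of_ne (not_lt.mp hlt) hij.symm)
  refine ⟨j - i, Nat.sub_pos_of_lt hlt, ?_⟩
  apply (σ ^ i).injective
  rw [← AlgEquiv.mul_apply, ← pow_add, Nat.add_sub_cancel' hlt.le]
  exact hval.symm

/-- **Over a henselian field, conjugation preserves values**: for `(K, O)` henselian, `L|K`
algebraic with the valuation ring `O_L` over `O`, and `σ ∈ Aut(L|K)`, `v(σ z) = v(z)` for all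
`z ∈ L`. PROVED: `σ` preserves `O_L` (uniqueness), so `v ∘ σ` and `v` define the same ring; if
`v(σ z) < v(z)` then `v(σ^{n+1} z) ≤ v(σ^n z)` inductively, contradicting `σ^n z = z` for some
`n ≥ 1`. [folklore] -/
theorem IsHenselianField.valuation_algEquiv_apply [Algebra.IsAlgebraic K L]
    (hK : IsHenselianField K O) (OL : ValuationSubring L) (hOL : OL.comap (algebraMap K L) = O)
    (σ : L ≃ₐ[K] L) (z : L) : OL.valuation (σ z) = OL.valuation z := by
  -- it suffices to prove `v z ≤ v (σ z)` for all `σ`, `z`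
  suffices key : ∀ (τ : L ≃ₐ[K] L) (y : L), OL.valuation y ≤ OL.valuation (τ y) by
    refine le_antisymm ?_ (key σ z)
    have h := key σ.symm (σ z)
    rwa [σ.symm_apply_apply] at h
  intro τ y
  by_contra hlt
  push Not at hlt
  have hy0 : y ≠ 0 := by
    rintro rfl
    rw [map_zero, map_zero] at hlt
    exact lt_irrefl _ hlt
  have hτy0 : ∀ n : ℕ, (τ ^ n) y ≠ 0 := fun n h0 => hy0 ((τ ^ n).injective (by rw [h0, map_zero]))
  have hτs : ∀ m : ℕ, τ ((τ ^ m) y) = (τ ^ (m + 1)) y := fun m => by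
    rw [pow_succ', AlgEquiv.mul_apply]
  -- `v(τ u) ≤ 1` whenever `v u ≤ 1`
  have hpres : ∀ u : L, OL.valuation u ≤ 1 → OL.valuation (τ u) ≤ 1 := fun u hu => by
    rw [OL.valuation_le_one_iff] at hu ⊢
    exact (hK.algEquiv_mem_iff OL hOL τ u).mpr hu
  -- `v(τ^(n+2) y) ≤ v(τ^(n+1) y)` by induction, starting from `v(τ y) < v(y)`
  have hstep : ∀ n : ℕ, OL.valuation ((τ ^ (n + 1)) y) ≤ OL.valuation ((τ ^ n) y) →
      OL.valuation ((τ ^ (n + 2)) y) ≤ OL.valuation ((τ ^ (n + 1)) y) := by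
    intro n hn
    have hq : OL.valuation ((τ ^ (n + 1)) y / (τ ^ n) y) ≤ 1 := by
      rw [map_div₀]
      exact div_le_one_of_le₀ hn zero_le
    have h2 := hpres _ hq
    rw [map_div₀, hτs, hτs, map_div₀] at h2
    have hpos : 0 < OL.valuation ((τ ^ (n + 1)) y) :=
      (Valuation.pos_iff _).mpr (hτy0 (n + 1))
    rwa [div_le_one₀ hpos] at h2
  have hchain : ∀ n : ℕ, OL.valuation ((τ ^ (n + 1)) y) ≤ OL.valuation (τ y) := by
    intro n
    induction n with
    | zero => simp
    | succ n ih =>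
      have h0 : OL.valuation ((τ ^ 1) y) ≤ OL.valuation ((τ ^ 0) y) := by
        simpa using hlt.le
      -- propagate the one-step inequality up to `n + 1`
      have hall : ∀ m : ℕ, OL.valuation ((τ ^ (m + 1)) y) ≤ OL.valuation ((τ ^ m) y) := by
        intro m
        induction m with
        | zero => exact h0
        | succ m ihm => exact hstep m ihm
      exact (hall (n + 1)).trans ih
  obtain ⟨n, hn, hfix⟩ := exists_pow_algEquiv_apply_eq τ y
  obtain ⟨m, rfl⟩ := Nat.exists_eq_succ_of_ne_zero hn.ne'
  have h := hchain m
  rw [hfix] at h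
  exact absurd (lt_of_le_of_lt h hlt) (lt_irrefl _)

/-- **Conjugate elements have the same value over a henselian field**: for `(K, O)` henselian,
`L|K` normal algebraic with valuation ring `O_L` over `O`, `K`-conjugate `x, y ∈ L` and any
`p ∈ K[X]`, `v(p(x)) = v(p(y))`. [folklore] -/
theorem IsHenselianField.valuation_aeval_eq_of_isConjRoot [Normal K L]
    (hK : IsHenselianField K O) (OL : ValuationSubring L) (hOL : OL.comap (algebraMap K L) = O)
    {x y : L} (h : IsConjRoot K x y) (p : K[X]) :
    OL.valuation (aeval x p) = OL.valuation (aeval y p) := by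
  obtain ⟨σ, rfl⟩ := h.exists_algEquiv
  rw [show σ y = (σ : L →ₐ[K] L) y from rfl, Polynomial.aeval_algHom_apply]
  exact hK.valuation_algEquiv_apply OL hOL σ _

end Conjugation


/-! ### The ambient form: henselian subfields of an algebraically closed valued field -/

section Ambient

variable {Ω : Type u} [Field Ω] [IsAlgClosed Ω] (V : ValuationSubring Ω)

/-- **Conjugates over a henselian subfield have the same value** (ambient form): for a subfield
`E ≤ Ω` of the algebraically closed valued field `(Ω, V)` with `(E, V ∩ E)` henselian, an
algebraic `α ∈ Ω`, an `E`-conjugate `β` of `α` (same minimal polynomial) and any `p ∈ E[X]`,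
`v(p(α)) = v(p(β))`. PROVED (inside the algebraic closure of `E` in `Ω`, which is normal over
`E`, from `IsHenselianField.valuation_aeval_eq_of_isConjRoot`). [folklore] -/
theorem IsHenselianField.valuation_aeval_eq_of_isConjRoot_of_subfield {E : Subfield Ω}
    (hE : IsHenselianField E (V.comap (algebraMap E Ω))) {α β : Ω} (hα : IsAlgebraic E α)
    (h : IsConjRoot E α β) (p : E[X]) :
    V.valuation (aeval α p) = V.valuation (aeval β p) := by
  set A : IntermediateField E Ω := algebraicClosure E Ω with hA
  have hαA : α ∈ A := mem_algebraicClosure_iff'.mpr hα.isIntegral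
  have hβint : IsIntegral E β := (IsConjRoot.isIntegral_iff h).mp hα.isIntegral
  have hβA : β ∈ A := mem_algebraicClosure_iff'.mpr hβint
  set OA : ValuationSubring A := V.comap (algebraMap A Ω) with hOA
  have hOAE : OA.comap (algebraMap E A) = V.comap (algebraMap E Ω) := by
    rw [hOA, ValuationSubring.comap_comap, ← IsScalarTower.algebraMap_eq]
  have hinj : Function.Injective (algebraMap A Ω) := (algebraMap A Ω).injective
  have hconj : IsConjRoot E (⟨α, hαA⟩ : A) ⟨β, hβA⟩ := by
    rw [isConjRoot_def, ← minpoly.algebraMap_eq hinj (⟨α, hαA⟩ : A),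
      ← minpoly.algebraMap_eq hinj (⟨β, hβA⟩ : A)]
    exact h
  have key := hE.valuation_aeval_eq_of_isConjRoot OA hOAE hconj p
  rw [← valuation_map_eq_iff (algebraMap A Ω) hOA.symm] at key
  rwa [← Polynomial.aeval_algebraMap_apply, ← Polynomial.aeval_algebraMap_apply] at key

/-- **Roots of the minimal polynomial are uniformly close to residue roots**: for a henselian
subfield `E ≤ Ω`, an algebraic `y ∈ Ω` and `Ψ ∈ E[X]` with `v(Ψ(y)) < 1`, every root `β ∈ Ω`
of the minimal polynomial of `y` over `E` satisfies `v(Ψ(β)) < 1` (the roots are the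
`E`-conjugates of `y`). This is the form in which "the residue polynomial of an irreducible
polynomial over a henselian field is a power of an irreducible polynomial" ([En] §17) is consumed
by the proof of Kuhlmann 2010, Prop. 2.18. PROVED. [folklore] -/
theorem IsHenselianField.valuation_aeval_lt_one_of_mem_aroots_minpoly {E : Subfield Ω}
    (hE : IsHenselianField E (V.comap (algebraMap E Ω))) {y : Ω} (hy : IsAlgebraic E y)
    {Ψ : E[X]} (hΨ : V.valuation (aeval y Ψ) < 1) {β : Ω} (hβ : β ∈ (minpoly E y).aroots Ω) :
    V.valuation (aeval β Ψ) < 1 := by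
  have hconj : IsConjRoot E y β := (isConjRoot_iff_mem_minpoly_aroots hy.isIntegral).mpr hβ
  rwa [hE.valuation_aeval_eq_of_isConjRoot_of_subfield V hy hconj Ψ] at hΨ

end Ambient

end Literature.AlgebraicGeometry.Resolution
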